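import Summits.CriticalPhenomena.CardyFormulaZ2.Theses.CardyIKTransport
import Summits.CriticalPhenomena.CardyFormulaZ2.Theses.CardyDiluteOrbit
import Summits.CriticalPhenomena.CardyFormulaZ2.Theorems.IKMixedBoxCrossing.Negative.IKMixedBoxCrossingNoBondFKG
import Literature.Probability.LatticeModels.CornerFugacityMeasure

/-!
# Line `defect-closure-exploration` — VOCABULARY + COMPOSITION (defs-only support file) for the crux
`IKMixedBoxCrossing` (crux item stmt-CriticalPhenomena-5911; routes CardyIKTransport r4 = CardyDiluteOrbit r2)

Statements by the planner crux-plan seat (round 1, `Cruxes/IKMixedBoxCrossing/Lines/defect_closure_exploration.lean`),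
landed by the gen-1 line lead prover-line-stmt-CriticalPhenomena-5911-1 (2026-08-16) so that the stub PROOF files
`Theorems/CardyIKTransportIKMixedBoxCrossingDefectStub<Name>.lean` (`--supports stmt-CriticalPhenomena-5911`) and the
lead's skeleton share one copy of every object.  Nothing here is asserted: every `def … : Prop` is a statement the LINE
POSITS; the registered stubs `stub_gadget`, `stub_closureMarkov`, `stub_polymerTail`, `stub_pureIK`, `stub_mixing`,
`stub_bridge` are NOT declared here (they are the sorries of the skeleton); `Registered.stub_*` are name-keyed aliases of
their statements and `IKMixedBoxCrossing_of_defectStubs` (itself a registered sub-goal) is the sorry-free composition concluding BOTH route decls by name through the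
landed `Negative.iff_named`.

THE LINE.  Write each Bernoulli(2√3−3) plaquette bit of an `S`-column face as (fair bit) ∧ ¬(mask), `P(mask) = ρ =
(1−t)/(1+t) = 7 − 4√3 ≈ 0.0718` (`t = √3/2`).  Then the free corner-fugacity field on ANY finite volume with ANY
interaction set `V ⊆ innerVertices Λ` is EXACTLY the i.i.d.-Bernoulli(ρ) mixture over masks `D ⊆ V` of the uniform
colourings even on `D` (`GadgetRepresentation`): the IK colour field is Bernoulli(½) site percolation in a sparse random
environment of parity-locked islands.  Exploring colours together with masks and CLOSING every mask polymer met, the law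
behind the frontier is the FREE field of the unexplored region, whatever was revealed (`ClosureMarkov`, an exact
free-boundary strong Markov property, every `S`); closures are subcritical king animals (`PolymerTail`, `7ρ < 1`,
`subcriticalMaskDensity` proved here).  `GaugeBridge` identifies the crux's infinite-volume gauge probabilities
`Negative.pH / pV` with the finite free-model probabilities `hfree / vfree`.  The two OPEN layers are registered as they
are: `PureIKBoxCrossing` (FKG-free RSW at the isotropic point — what Smirnov's symmetric-domain scheme consumes here is a
junction estimate at a rough closure-explored frontier, crux NOTES §3–§5/§7) and `MixedBoxCrossingFree` (the `∀ S` layer).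

RESHAPE (gen-1 lead, recorded in `Cruxes/IKMixedBoxCrossing/PICKED.md`): the planner's `JunctionLemma` ("arrival likely
under `boxLaw Λ` ⇒ boundedly likely under `boxLaw (Λ ∖ F)`", all `F, A, T`) is not registered — it has no valid consumer
(the a-priori bound available in the single-exploration step is under the free field of the mirror-attached region, never
under `boxLaw Λ` for the explored `F`) and, quantified over arbitrary `F`, it is exposed to amplification over exponentially
many curtain-separated notched corridors (`boxLaw Λ` restricted to a notched corridor differs from its free field by
`ρ^{w+1}` couplings across width-`w` notches).

DISPROOF USED (`Cruxes/IKMixedBoxCrossing/Disproof.lean`, cdisprove; landed `Theorems/IKMixedBoxCrossing/Negative/*`,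
imported): `iff_named` (composition), `iKMixedBoxCrossing_false_without_n_pos` (`1 ≤ n` kept in `PureIKBoxCrossing`,
`MixedBoxCrossingFree`), `pH_one_zero_zero` / `c_le_quarter` / `not_IKMixedBoxCrossing_with_large_constant` (all constants
existential), `colourField_not_positivelyAssociated` / `bondField_not_positivelyAssociated` (no statement here uses
association).  No `def` below is an instance or rewording of a landed Negative lemma or of the negatives index.
-/

set_option linter.dupNamespace false

noncomputable section

namespace Summit.CriticalPhenomena.CardyFormulaZ2.Cruxes.IKMixedBoxCrossing.DefectClosureExploration

open scoped BigOperators Classical ENNReal NNReal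
open MeasureTheory Finset
open Literature.Probability.Percolation Literature.Probability.LatticeModels
open Summit.CriticalPhenomena.CardyFormulaZ2.Theorems.IKMixedBoxCrossing

/-! ## §0 Constants of the isotropic Izergin–Korepin point -/

/-- Corner fugacity of the isotropic IK point, `t = √3/2` (`= p/(1-p)`, `p = 2√3 − 3`). -/
def tIK : ℝ≥0 := ⟨Real.sqrt 3 / 2, by positivity⟩

/-- Mask density of fugacity `t`: `ρ(t) = (1 − t)/(1 + t)` (so `1 − ρ = 2t/(1+t)` and
`t^[odd] = (1+t)/2 · ((1 − ρ) + 2ρ·[even])`). -/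
def maskDensity (t : ℝ) : ℝ := (1 - t) / (1 + t)

/-- `ρ(√3/2) = 7 − 4√3 ≈ 0.0718`. -/
def ρIK : ℝ := 7 - 4 * Real.sqrt 3

/-- `tIK` coerced to `ℝ` is `√3/2`. -/
theorem coe_tIK : ((tIK : ℝ≥0) : ℝ) = Real.sqrt 3 / 2 := rfl

/-- The mask density at the IK point is `7 − 4√3`. -/
theorem maskDensity_tIK : maskDensity tIK = ρIK := by
  have h3 : Real.sqrt 3 ^ 2 = 3 := Real.sq_sqrt (by norm_num)
  have h0 : 0 ≤ Real.sqrt 3 := Real.sqrt_nonneg 3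
  rw [maskDensity, coe_tIK, ρIK, div_eq_iff (by positivity)]
  nlinarith [h3, h0]

/-- `0 < ρ < 1/7`: closures are subcritical by path counting (`7ρ = 49 − 28√3 ≈ 0.5026`). -/
theorem ρIK_pos : 0 < ρIK := by
  have h3 : Real.sqrt 3 ^ 2 = 3 := Real.sq_sqrt (by norm_num)
  have h0 : 0 ≤ Real.sqrt 3 := Real.sqrt_nonneg 3
  rw [ρIK]; nlinarith [h3, h0]

/-- `7ρ < 1` at the IK point (`7(7 − 4√3) = 49 − 28√3 < 1` since `√3 > 12/7`). -/
theorem seven_mul_ρIK_lt_one : 7 * ρIK < 1 := by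
  have h3 : Real.sqrt 3 ^ 2 = 3 := Real.sq_sqrt (by norm_num)
  have h0 : 0 ≤ Real.sqrt 3 := Real.sqrt_nonneg 3
  rw [ρIK]; nlinarith [h3, h0]

/-! ## §1 The finite-volume free mixed model (column pattern `S`: isotropic faces, the rest honeycomb) -/

/-- Interaction faces of the pattern `S` in the volume `Λ`: inner faces of `Λ` lying in an `S`-column
(faces in `ℤ ∖ S` columns carry fugacity `1`, i.e. are omitted). -/
def facesIn (S : Set ℤ) (Λ : Finset (Site 2)) : Finset (Site 2) :=
  (innerVertices Λ).filter fun v => v 0 ∈ S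

/-- The FREE mixed colour field on `Λ` for the pattern `S` (white outside `Λ`; the values off `Λ` are never read). -/
def colourLaw (S : Set ℤ) (Λ : Finset (Site 2)) : Measure (Site 2 → Bool) :=
  cornerGibbsMeasure tIK (facesIn S Λ) Λ (fun _ => false)

/-- Colours and i.i.d. fair coins (a coin is read only on `S`-faces). -/
def boxLaw (S : Set ℤ) (Λ : Finset (Site 2)) : Measure CellConfig :=
  (colourLaw S Λ).prod (coinMeasure half)

/-- Faces carrying the ANTI-diagonal: forced off `S`, the coin on `S` (verbatim the gauge's `anti`). -/
def antiFaces (S : Set ℤ) (κ : Site 2 → Bool) : Set (Site 2) := {f | f 0 ∉ S ∨ κ f = true}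

/-- Open edges of the mixed triangulation between black cells (verbatim the gauge's `edges`, read from `(σ, κ)`). -/
def mixedEdges (S : Set ℤ) (x : CellConfig) : BondConfig (Site 2) :=
  {e | ∃ u v : Site 2, e = s(u, v) ∧ x.1 u = true ∧ x.1 v = true ∧
    (v = u + ![1, 0] ∨ v = u + ![0, 1] ∨ (v = u + ![1, 1] ∧ u ∉ antiFaces S x.2) ∨
      (v = u + ![1, -1] ∧ (u + ![0, -1]) ∈ antiFaces S x.2))}

/-- The cell rectangle `[a, a+W) × [b, b+H)` as a finite set. -/
def cellRect (a b : ℤ) (W H : ℕ) : Finset (Site 2) :=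
  ((Finset.Ico a (a + W)) ×ˢ (Finset.Ico b (b + H))).image fun p => ![p.1, p.2]

/-- The same rectangle as a set of cells. -/
def rectSet (a b : ℤ) (W H : ℕ) : Set (Site 2) := {v | a ≤ v 0 ∧ v 0 < a + W ∧ b ≤ v 1 ∧ v 1 < b + H}

/-- Black left–right crossing of `[a, a+W) × [b, b+H)`. -/
def lrEvent (S : Set ℤ) (a b : ℤ) (W H : ℕ) : Set CellConfig :=
  {x | mixedEdges S x ∈ openCrossing (rectSet a b W H) {v | v 0 = a ∧ b ≤ v 1 ∧ v 1 < b + H}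
    {v | v 0 = a + W - 1 ∧ b ≤ v 1 ∧ v 1 < b + H}}

/-- Black bottom–top crossing of `[a, a+W) × [b, b+H)`. -/
def tbEvent (S : Set ℤ) (a b : ℤ) (W H : ℕ) : Set CellConfig :=
  {x | mixedEdges S x ∈ openCrossing (rectSet a b W H) {v | v 1 = b ∧ a ≤ v 0 ∧ v 0 < a + W}
    {v | v 1 = b + H - 1 ∧ a ≤ v 0 ∧ v 0 < a + W}}

/-- Free-field probability of a black left–right crossing of the `W × H` box at `(a, b)`. -/
def hfree (S : Set ℤ) (a b : ℤ) (W H : ℕ) : ℝ := (boxLaw S (cellRect a b W H)).real (lrEvent S a b W H)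

/-- Free-field probability of a black bottom–top crossing of the `W × H` box at `(a, b)`. -/
def vfree (S : Set ℤ) (a b : ℤ) (W H : ℕ) : ℝ := (boxLaw S (cellRect a b W H)).real (tbEvent S a b W H)

/-! ## §2 Stub statement 1 — the gadget / mask representation (exact identity) -/

/-- GADGET REPRESENTATION (card (1); = `parity-lock-gadgets`' first lemma). For `t ≤ 1`, every finite volume
`Λ`, every FREE interaction set `V ⊆ innerVertices Λ` and every boundary condition, the corner Gibbs measure is
the mixture over masks `D ⊆ V`, with i.i.d. Bernoulli(`ρ(t)`) weights, of the `t = 0` members with interaction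
set `D` — i.e. of the uniform colourings conditioned to have no odd face in `D`. (Proof: `t^[odd_f] =
(1+t)/2·((1−ρ) + 2ρ[even_f])`; expand the product over `V`; `#{fillings even on D} = 2^{|Λ|−|D|}` because the
face-parity functionals of `D ⊆ innerVertices Λ` are `𝔽₂`-independent — the lexicographically maximal face of a
dependency owns its NE cell alone.) Size M. -/
def GadgetRepresentation : Prop :=
  ∀ (t : ℝ≥0), t ≤ 1 → ∀ (V Λ : Finset (Site 2)), V ⊆ innerVertices Λ → ∀ (ξ : Site 2 → Bool),
    cornerGibbsMeasure t V Λ ξ =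
      ∑ D ∈ V.powerset,
        ENNReal.ofReal (maskDensity t ^ D.card * (1 - maskDensity t) ^ (V.card - D.card)) •
          cornerGibbsMeasure 0 D Λ ξ

/-! ## §3 Stub statement 2 — the closure-exploration strong Markov property (exact, free boundary) -/

/-- Faces of `V` meeting the cell set `F`. -/
def facesMeeting (V F : Finset (Site 2)) : Finset (Site 2) := V.filter fun v => (cellFace v ∩ F).Nonempty

/-- Faces of `V` lying inside the cell set `G`. -/
def facesInside (V G : Finset (Site 2)) : Finset (Site 2) := V.filter fun v => cellFace v ⊆ G

/-- The mask-mixture functional: `Σ_{D ⊆ V} ρ^|D| (1−ρ)^|V∖D| · μ_0^D(E_D)` — the joint law of (mask, colouring)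
evaluated on a mask-dependent event. -/
def maskMix (ρ : ℝ) (V Λ : Finset (Site 2)) (ξ : Site 2 → Bool) (E : Finset (Site 2) → Set (Site 2 → Bool)) : ℝ≥0∞ :=
  ∑ D ∈ V.powerset, ENNReal.ofReal (ρ ^ D.card * (1 - ρ) ^ (V.card - D.card)) * cornerGibbsMeasure 0 D Λ ξ (E D)

/-- An exploration rule `(mask, colouring) ↦ explored cell set` is a STOPPING rule: its value `F` is determined
by the colours on `F` and the mask status of the faces meeting `F`. -/
def IsStoppingRule (V : Finset (Site 2)) (explore : Finset (Site 2) → (Site 2 → Bool) → Finset (Site 2)) : Prop :=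
  ∀ (D D' : Finset (Site 2)) (σ σ' : Site 2 → Bool), D ⊆ V → D' ⊆ V →
    (∀ c ∈ explore D σ, σ' c = σ c) →
    D' ∩ facesMeeting V (explore D σ) = D ∩ facesMeeting V (explore D σ) →
    explore D' σ' = explore D σ

/-- The rule is CLOSED: it stays in `Λ` and every masked face meeting the explored set lies inside it (mask
polymers met are closed). -/
def IsClosedRule (V Λ : Finset (Site 2)) (explore : Finset (Site 2) → (Site 2 → Bool) → Finset (Site 2)) : Prop :=
  ∀ (D : Finset (Site 2)) (σ : Site 2 → Bool), D ⊆ V →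
    explore D σ ⊆ Λ ∧ ∀ v ∈ D, (cellFace v ∩ explore D σ).Nonempty → cellFace v ⊆ explore D σ

/-- A predicate on (mask, colouring) read from INSIDE the explored set (revealed data). -/
def InsideDetermined (V : Finset (Site 2)) (explore : Finset (Site 2) → (Site 2 → Bool) → Finset (Site 2))
    (A : Finset (Site 2) → (Site 2 → Bool) → Prop) : Prop :=
  ∀ (D D' : Finset (Site 2)) (σ σ' : Site 2 → Bool), D ⊆ V → D' ⊆ V → A D σ →
    (∀ c ∈ explore D σ, σ' c = σ c) →
    D' ∩ facesMeeting V (explore D σ) = D ∩ facesMeeting V (explore D σ) → A D' σ'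

/-- An event of colourings determined by the cells of `G`. -/
def DeterminedOn (G : Finset (Site 2)) (B : Set (Site 2 → Bool)) : Prop :=
  ∀ σ σ' : Site 2 → Bool, (∀ c ∈ G, σ c = σ' c) → (σ ∈ B ↔ σ' ∈ B)

/-- CLOSURE-EXPLORATION MARKOV PROPERTY (card (2); triage F8 "TRUE, stopping-set argument"). For `t ≤ 1`,
`V ⊆ innerVertices Λ`, a closed stopping rule and revealed data `A`: on `{explored set = F} ∩ A`, the colours of
`G = Λ ∖ F` are distributed as the FREE field of `G` at the same fugacity with interaction set the faces of `V`
inside `G` (faces straddling `∂F` are unmasked, i.e. at fugacity `1`), independently of the revealed data.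
(Proof: `V = facesMeeting V F ⊔ facesInside V G`; by closedness the masked faces meeting `F` constrain only
`σ|_F`, so the weight `ρ^|D|(1−ρ)^|V∖D| 2^|D| 1[σ even on D]` factorises over `(D ∩ facesMeeting, σ|_F)` and
`(D ∩ facesInside, σ|_G)`, and the second factor re-sums to the free field of `G` by `GadgetRepresentation`.)
Size L. -/
def ClosureMarkov : Prop :=
  ∀ (t : ℝ≥0), t ≤ 1 → ∀ (V Λ : Finset (Site 2)), V ⊆ innerVertices Λ → ∀ (ξ : Site 2 → Bool)
    (explore : Finset (Site 2) → (Site 2 → Bool) → Finset (Site 2)),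
    IsStoppingRule V explore → IsClosedRule V Λ explore →
    ∀ (A : Finset (Site 2) → (Site 2 → Bool) → Prop), InsideDetermined V explore A →
    ∀ (F : Finset (Site 2)) (B : Set (Site 2 → Bool)), DeterminedOn (Λ \ F) B →
      maskMix (maskDensity t) V Λ ξ (fun D => {σ | explore D σ = F ∧ A D σ ∧ σ ∈ B}) =
        maskMix (maskDensity t) V Λ ξ (fun D => {σ | explore D σ = F ∧ A D σ}) *
          cornerGibbsMeasure t (facesInside V (Λ \ F)) (Λ \ F) (fun _ => false) B

/-! ## §4 Stub statement 3 — mask polymers are subcritical (closures have exponential diameter tails) -/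

/-- King adjacency of faces (= faces sharing a cell). -/
def kingGraph : SimpleGraph (Site 2) :=
  SimpleGraph.fromRel fun f g : Site 2 => |f 0 - g 0| ≤ 1 ∧ |f 1 - g 1| ≤ 1

/-- `f` and `g` are joined by a king path of masked faces (faces of `D`). -/
def KingLinked (D : Finset (Site 2)) (f g : Site 2) : Prop :=
  ∃ (hf : f ∈ (↑D : Set (Site 2))) (hg : g ∈ (↑D : Set (Site 2))),
    (kingGraph.induce (↑D : Set (Site 2))).Reachable ⟨f, hf⟩ ⟨g, hg⟩

/-- Bernoulli(`ρ`)-on-`V` probability that the mask polymer of the face `f` reaches sup-distance `≥ r`. -/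
def maskTail (ρ : ℝ) (V : Finset (Site 2)) (f : Site 2) (r : ℕ) : ℝ :=
  ∑ D ∈ V.powerset,
    if (∃ g : Site 2, KingLinked D f g ∧ (r : ℤ) ≤ max |g 0 - f 0| |g 1 - f 1|)
    then ρ ^ D.card * (1 - ρ) ^ (V.card - D.card) else 0

/-- POLYMER TAIL (card (2) "Cost"; triage "7ρ = 0.503 < 1 ✓"). A polymer reaching sup-distance `r` contains a
self-avoiding king walk of `r` steps from `f`, all masked: `≤ 8·7^{r−1} ρ^{r+1} ≤ (7ρ)^r` of them in
expectation. With `ρ = ρIK`, `seven_mul_ρIK_lt_one` makes closures exponentially small, uniformly in `V`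
(hence in `S` and in the volume). Size S–M. -/
def PolymerTail : Prop :=
  ∀ (ρ : ℝ), 0 ≤ ρ → ρ ≤ 1 → ∀ (V : Finset (Site 2)) (f : Site 2) (r : ℕ), maskTail ρ V f r ≤ (7 * ρ) ^ r

/-- SUBCRITICAL MASK DENSITY at the IK point: `0 < ρ(√3/2) = 7 − 4√3` and `7ρ < 1` — what makes `PolymerTail`
bite (proved below, `subcriticalMaskDensity`; recorded as a named hypothesis of the consumers so that the place
where the smallness of `ρ` enters is visible in the registered signatures). -/
def SubcriticalMaskDensity : Prop := 0 < maskDensity tIK ∧ 7 * maskDensity tIK < 1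

/-- `SubcriticalMaskDensity` holds (sorry-free). -/
theorem subcriticalMaskDensity : SubcriticalMaskDensity := by
  refine ⟨?_, ?_⟩
  · rw [maskDensity_tIK]; exact ρIK_pos
  · rw [maskDensity_tIK]; exact seven_mul_ρIK_lt_one

/-! ## §6 Stub statements 5–7 — pure-IK box crossings, the `∀ S` layer, the gauge bridge -/

/-- PURE-IK BOX CROSSINGS (OPEN layer 1 — FKG-free RSW at the isotropic point): uniform long-way crossings of
the `2n × n` and `n × 2n` boxes whose interior face-columns are all isotropic (`S ⊇` the box's face-columns; the
free field of the box then IS the isotropic IK model — `D₄`-symmetric, self-dual: squares are crossed with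
probability exactly `½`, landed as `XorRectangleFlip.isotropyFloor_univ` for the gauge).  What Smirnov's
symmetric-domain scheme (tree `SmirnovRSW` / `TriThetaHalf.rsw_doubling`) consumes here, once `ClosureMarkov`
supplies the exact free field behind a closure-explored frontier, is a JUNCTION estimate at that rough frontier:
(i) conditioning step — `free(band ∖ F)(B_F) ≥ κ` given `free(band ∖ ΘF)(B_F) ≥ ½` (single exploration of the
left column's white cluster, mirror `Θ` in the axis row, padding device; pathwise valid on the random
triangulation, crux NOTES §5), (ii) the `A′ ∩ ΘA′` gluing replacing Harris (second-moment / contact form, crux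
NOTES §7 (F4)).  Both hold numerically with room (kit j015217, j015922/3, j015989); neither has an FKG-free
proof — this is the crux's wall (crux NOTES §3–§4), registered here as it is. -/
def PureIKBoxCrossing : Prop :=
  ∃ c : ℝ, 0 < c ∧ ∀ (S : Set ℤ) (n : ℕ) (a b : ℤ), 1 ≤ n →
    ((∀ x : ℤ, a ≤ x → x + 1 < a + 2 * n → x ∈ S) → c ≤ hfree S a b (2 * n) n) ∧
    ((∀ x : ℤ, a ≤ x → x + 1 < a + n → x ∈ S) → c ≤ vfree S a b n (2 * n))

/-- MIXED BOX CROSSINGS in the free finite-volume model: the crux's conclusion for every column pattern `S`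
(by `GaugeBridge` this is literally the named form of the crux). -/
def MixedBoxCrossingFree : Prop :=
  ∃ c : ℝ, 0 < c ∧ ∀ (S : Set ℤ) (n : ℕ) (a b : ℤ), 1 ≤ n →
    c ≤ hfree S a b (2 * n) n ∧ c ≤ vfree S a b n (2 * n)

/-- GAUGE BRIDGE (card "Disproof used (iii)": "the one bookkeeping bridge a line must file"; refuter facts
F1/F2 on stmt-5911: face parity = plaquette bit, box marginal of the gauge = free plaquette field with uniform
first row/column ⊗ independent inner-face parities, Bernoulli(2√3−3) = t/(1+t) on `S`-columns, fair elsewhere;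
coins i.i.d. fair). The crux's crossing probabilities `pH`, `pV` (named gauge pieces, Theorems/…/Negative) are
the free-model probabilities `hfree`, `vfree`. Size M–L (product-measure push-forward; `n = 0` gives `0 = 0`). -/
def GaugeBridge : Prop :=
  ∀ (S : Set ℤ) (n : ℕ) (a b : ℤ),
    Negative.pH S n a b = hfree S a b (2 * n) n ∧ Negative.pV S n a b = vfree S a b n (2 * n)

/-! ## §7 The composition (sorry-free) -/

/-- Mixed free-model crossings + the gauge bridge give the named form of the crux. -/
theorem mixedNamed_of (hB : GaugeBridge) (hM : MixedBoxCrossingFree) :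
    ∃ c : ℝ, 0 < c ∧ ∀ S : Set ℤ, ∀ n : ℕ, 1 ≤ n → ∀ a b : ℤ,
      c ≤ Negative.pH S n a b ∧ c ≤ Negative.pV S n a b := by
  obtain ⟨c, hc, h⟩ := hM
  refine ⟨c, hc, fun S n hn a b => ?_⟩
  obtain ⟨h1, h2⟩ := hB S n a b
  rw [h1, h2]
  exact h S n a b hn

/-! ## §8 Registered stubs (name-keyed aliases) and the composition

`stub_*` are the registered obligations (the sorries of the skeleton `Cruxes/IKMixedBoxCrossing/Lines/defect_closure_exploration.lean`).
`Registered.stub_*` are `abbrev` aliases of their statements keyed by the registered names, taken as the hypotheses of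
`IKMixedBoxCrossing_of_defectStubs` (same device as `Theorems/CardyIKTransportIKMixedBoxCrossingXorDefs.lean`). -/

namespace Registered

/-- Alias of `GadgetRepresentation` keyed by the registered stub name. -/
abbrev stub_gadget : Prop := GadgetRepresentation
/-- Alias of `GadgetRepresentation → ClosureMarkov` keyed by the registered stub name. -/
abbrev stub_closureMarkov : Prop := GadgetRepresentation → ClosureMarkov
/-- Alias of `PolymerTail` keyed by the registered stub name. -/
abbrev stub_polymerTail : Prop := PolymerTail
/-- Alias of the isotropic (pure-IK) RSW layer keyed by the registered stub name (OPEN). -/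
abbrev stub_pureIK : Prop := ClosureMarkov → PolymerTail → SubcriticalMaskDensity → PureIKBoxCrossing
/-- Alias of the `∀ S` layer keyed by the registered stub name (OPEN). -/
abbrev stub_mixing : Prop :=
  ClosureMarkov → PolymerTail → SubcriticalMaskDensity → PureIKBoxCrossing → MixedBoxCrossingFree
/-- Alias of `GaugeBridge` keyed by the registered stub name. -/
abbrev stub_bridge : Prop := GaugeBridge

end Registered

/-- **`IKMixedBoxCrossing` from the six stubs** (real proof, no `sorry`): closure-Markov from the gadget representation;
pure-IK crossings from the tools; the `∀ S` layer; the gauge bridge rewrites the finite free-model statement into the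
named form, which is the crux by `Negative.iff_named`. -/
theorem IKMixedBoxCrossing_of_defectStubs :
    Registered.stub_gadget → Registered.stub_closureMarkov → Registered.stub_polymerTail →
      Registered.stub_pureIK → Registered.stub_mixing → Registered.stub_bridge →
      Summit.CriticalPhenomena.CardyFormulaZ2.Theses.CardyIKTransport.IKMixedBoxCrossing := by
  intro hG hCM hPT hPure hMix hB
  have hcm : ClosureMarkov := hCM hG
  have hpure : PureIKBoxCrossing := hPure hcm hPT subcriticalMaskDensity
  exact Negative.iff_named.2 (mixedNamed_of hB (hMix hcm hPT subcriticalMaskDensity hpure))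

/-- The same six stubs conclude `CardyDiluteOrbit.IKMixedBoxCrossing` BY NAME (item stmt-CriticalPhenomena-5911 is
shared; the two route decls are textually identical, so the proof is the previous one up to definitional unfolding). -/
theorem IKMixedBoxCrossing_of_defectStubs_diluteOrbit :
    Registered.stub_gadget → Registered.stub_closureMarkov → Registered.stub_polymerTail →
      Registered.stub_pureIK → Registered.stub_mixing → Registered.stub_bridge →
      Summit.CriticalPhenomena.CardyFormulaZ2.Theses.CardyDiluteOrbit.IKMixedBoxCrossing := by
  intro hG hCM hPT hPure hMix hB
  have h := IKMixedBoxCrossing_of_defectStubs hG hCM hPT hPure hMix hB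
  exact h

end Summit.CriticalPhenomena.CardyFormulaZ2.Cruxes.IKMixedBoxCrossing.DefectClosureExploration

end
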